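import Literature.AnabelianGeometry.AbsoluteAnabelian.AbsTopIII.Cor110ProfiniteGalois
import HarnessLib

/-!
# [AbsTopIII] Cor. 1.10 (iii), Galois side, PROFINITE version — the THREE SHAPES of the clause (HGAL)^prof and
# their equivalence (companion of `Cor110ProfiniteGalois.lean`; GAP-LEDGER G-L5t16g8-1)

S. Mochizuki, *Topics in Absolute Anabelian Geometry III: Global Reconstruction Algorithms*, §1, Cor. 1.10 (iii)
p. 43 l. 27–30 with its functoriality sentence p. 44 l. 33–34 and Rmk. 1.10.1 (i), Rmk. 1.9.2 (author's manuscript,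
kurims render url-5493eb38cbb7) [cite: MochizukiAbsTopIII2015, Cor 1.10 (iii) p.43]; background: restriction maps
between absolute Galois groups and the uniqueness of algebraic closures (Milne, *Fields and Galois Theory* §7;
Neukirch, *Algebraic Number Theory* Ch. II Thm. (4.8), Ch. IV §1).

COMPANION (abc-iut cell, block C / F wave, abc-iut-f-052 gen 8; row «E2b-PROFINITE-GLUE», deconflicted with
abc-iut-L5-t16 gen 9's file (A) `Cor110ProfiniteGalois.lean`, p490358, 2026-08-27 03:07Z) of the profinite Galois-side
retype of [AbsTopIII] Cor. 1.10 (iii) (`AbsTopIII.ProfiniteAutOverGQp E B` / `CurveModel.Cor_1_10_iii_galois`,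
abc-iut-L5-t16).  The clause

  (HGAL)^prof  «every topological automorphism `α` of `Π` lies over an inner automorphism of `G_{ℚ_p}`:
               `∀ α ∃ τ ∀ x, j(aug(α x)) = τ · j(aug x) · τ⁻¹`»

is written in the tree in THREE shapes, according to where `τ` lives and what `j : G_k → (⋯)` is:

* (abs)  `τ ∈ Gal(ℚ̄_p/ℚ_p) = Field.absoluteGaloisGroup ℚ_[p]`, `j = absGaloisRestrict ℚ_[p] K ∘ galIso` — the
  shape of `AbsTopIII.ProfiniteAutOverGQp` (file (A)); `absGaloisRestrict` is the tree's restriction map along the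
  CHOSEN embedding `ι : ℚ̄_p → K̄` (`absClosureEmbedding ℚ_[p] K`);
* (res)  `τ ∈ Aut_{ℚ_p}(K̄)`, `K̄ := AlgebraicClosure K`, `j = res ∘ galIso`, `res` = restriction of scalars
  `Gal(K̄/K) → Aut_{ℚ_p}(K̄)` — the shape of the binder `hconj` of abc-iut-L5's
  `InitialThetaData.splitFromF_goodLocalFrobenioidOfEmb_of_conj_restrictScalars` (p475217); here:
  `FundamentalExtension.MLFBase.ProfiniteHGal`;
* (aut)  `τ ∈ Aut_{ℚ_p}(ℚ̄_p)`, `j = e.autCongr ∘ res ∘ galIso` for a DISPLAYED `ℚ_p`-isomorphism `e : K̄ ≃ ℚ̄_p` — the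
  shape of the binder `hconj` of `…_of_conj_autCongr` and of the layer-5 certificate conjunct
  `layer5_held_ex33iii_e_v18_conj`; here: `FundamentalExtension.AutLiesOverInner E (B.toGQp e)`.

PROVED HERE (classical Galois theory only; nothing of [AbsTopIII] is asserted or used):
* the generic predicate `FundamentalExtension.AutLiesOverInner E j` («every topological automorphism of `Π` lies,
  through `j : G → Γ`, over an inner automorphism of `Γ`») is stable under post-composition (`.map`) and INVARIANT
  under isomorphisms of the target group (`autLiesOverInner_comp_mulEquiv_iff`); inner automorphisms of `Π` always
  satisfy the clause (`exists_conj_of_inner`);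
* for `K/ℚ_p` finite the chosen embedding `ι : ℚ̄_p → K̄` is an ISOMORPHISM (`K̄` is an algebraic closure of `ℚ_p`:
  `MLFBase.padicClosureEquiv`), and the tree's `absGaloisRestrict ℚ_[p] K` IS restriction of scalars followed by
  `ι⁻¹ ∘ (·) ∘ ι` (`MLFBase.absGaloisRestrict_eq_autCongr`);
* hence **(abs) ⟺ (res) ⟺ (aut) for every `e`** (`AbsTopIII.profiniteAutOverGQp_iff_profiniteHGal`,
  `AbsTopIII.profiniteAutOverGQp_iff_autLiesOverInner_toGQp`), (aut) does not depend on `e`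
  (`MLFBase.autLiesOverInner_toGQp_iff_toGQp`), and such an `e` exists (`MLFBase.nonempty_algEquiv_padic`); the
  consumer-ready unfoldings `AbsTopIII.ProfiniteAutOverGQp.exists_conj_restrictScalars` / `….exists_conj_autCongr`
  deliver the two `hconj` binders VERBATIM from the by-name fact, and
  `CurveModel.Cor_1_10_iii_galois.profiniteAutOverGQp` / `….exists_conj_restrictScalars` read the named fact of
  file (A) at a curve of the model through the model's own `galIso` (`CurveModel.galEquiv`).

Small `def`s (homomorphisms / an isomorphism / a predicate, each with its printed locator): `resAutPadic`,
`FundamentalExtension.AutLiesOverInner`, `MLFBase.galRes`, `MLFBase.ProfiniteHGal`, `MLFBase.toGQp`,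
`MLFBase.padicClosureEquiv`, `CurveModel.galEquiv`.  No instance / notation / axiom; no new named fact (the named
fact is (A)'s `CurveModel.Cor_1_10_iii_galois`).  HONEST FRAMING: (HGAL)^prof at a genuine `Π_X` is [AbsTopIII]
Cor. 1.10 (iii) in print and an ASSUMPTION LABEL in the tree; this file only relates typed shapes of that label;
typed ≠ proved; no side is taken on [IUTchIII] Cor. 3.12; nothing here bears on the truth of abc.
-/

noncomputable section


namespace Literature.AnabelianGeometry.AbsoluteAnabelian

open Field Literature.NumberTheory.GaloisRepresentations

universe u v w

/-! ### Restriction of scalars `Gal(K̄/K) → Aut_{ℚ_p}(K̄)` -/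

/-- For a field `K` with `ℚ_p ⊆ K`: restriction of scalars `Gal(K̄/K) = Aut_K(K̄) → Aut_{ℚ_p}(K̄)`,
`K̄ := AlgebraicClosure K`, as a homomorphism of groups — the inclusion `G_k ↪ G_{ℚ_p}` of [AbsTopIII] Cor. 1.10 read
inside `Aut(K̄)` (Mathlib's `AlgEquiv.restrictScalarsHom` on the carrier `Field.absoluteGaloisGroup K`).
[cite: MochizukiAbsTopIII2015, Cor 1.10 p.41] -/
def resAutPadic (p : ℕ) [Fact p.Prime] (K : Type u) [Field K] [Algebra ℚ_[p] K] :
    absoluteGaloisGroup K →* (AlgebraicClosure K ≃ₐ[ℚ_[p]] AlgebraicClosure K) :=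
  (AlgEquiv.restrictScalarsHom ℚ_[p]).comp (absoluteGaloisGroup.toAlgEquiv K).toMonoidHom

/-- `resAutPadic` is restriction of scalars. [cite: MochizukiAbsTopIII2015, Cor 1.10 p.41] -/
@[simp] theorem resAutPadic_apply (p : ℕ) [Fact p.Prime] (K : Type u) [Field K] [Algebra ℚ_[p] K]
    (σ : absoluteGaloisGroup K) :
    resAutPadic p K σ = (absoluteGaloisGroup.toAlgEquiv K σ).restrictScalars ℚ_[p] := rfl

/-- `resAutPadic` on elements of `K̄`: `(res σ) x = σ • x`. [cite: MochizukiAbsTopIII2015, Cor 1.10 p.41] -/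
theorem resAutPadic_apply_apply (p : ℕ) [Fact p.Prime] (K : Type u) [Field K] [Algebra ℚ_[p] K]
    (σ : absoluteGaloisGroup K) (x : AlgebraicClosure K) : resAutPadic p K σ x = σ • x := rfl

/-- Restriction of scalars `Gal(K̄/K) → Aut_{ℚ_p}(K̄)` is injective. [cite: MochizukiAbsTopIII2015, Cor 1.10 p.41] -/
theorem resAutPadic_injective (p : ℕ) [Fact p.Prime] (K : Type u) [Field K] [Algebra ℚ_[p] K] :
    Function.Injective (resAutPadic p K) :=
  (AlgEquiv.restrictScalarsHom_injective ℚ_[p]).comp (absoluteGaloisGroup.toAlgEquiv K).injective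

namespace FundamentalExtension

variable (E : FundamentalExtension.{u})

/-! ### (HGAL) through a homomorphism `j : G → Γ` -/

/-- **Every topological automorphism of `Π` lies, through `j`, over an inner automorphism of `Γ`**: for an extension
`1 → Δ → Π → G → 1` (abc-iut-L4's interface) and a homomorphism `j : G → Γ` into a group `Γ` — for every
`α : Π ≃ₜ* Π` there is `τ ∈ Γ` with `j(aug(α x)) = τ · j(aug x) · τ⁻¹` for all `x ∈ Π`.  The common shape of the
Galois side of the functoriality of [AbsTopIII] Cor. 1.10 (iii) («functorial […] from the profinite group `Π_X`»,
p. 43 l. 27–30; p. 44 l. 33–34) for the various incarnations of `G_k ↪ G_{ℚ_p}`.  A PREDICATE; nothing is asserted.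
[cite: MochizukiAbsTopIII2015, Cor 1.10 (iii) p.43] -/
def AutLiesOverInner {Γ : Type v} [Group Γ] (j : E.gal →* Γ) : Prop :=
  ∀ α : E.arith ≃ₜ* E.arith, ∃ τ : Γ, ∀ x : E.arith, j (E.aug (α x)) = τ * j (E.aug x) * τ⁻¹

variable {E}

/-- (HGAL) through `j` implies (HGAL) through `ψ ∘ j` for every homomorphism `ψ : Γ → Γ′` (take `ψ τ`).
[cite: MochizukiAbsTopIII2015, Cor 1.10 (iii) p.43] -/
theorem AutLiesOverInner.map {Γ : Type v} {Γ' : Type w} [Group Γ] [Group Γ'] {j : E.gal →* Γ}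
    (h : E.AutLiesOverInner j) (ψ : Γ →* Γ') : E.AutLiesOverInner (ψ.comp j) := by
  intro α
  obtain ⟨τ, hτ⟩ := h α
  refine ⟨ψ τ, fun x => ?_⟩
  simp only [MonoidHom.coe_comp, Function.comp_apply, hτ x, map_mul, map_inv]

/-- (HGAL) through `j` is INVARIANT under isomorphisms of the target group: for `ψ : Γ ≃* Γ′`, (HGAL) through `ψ ∘ j`
iff (HGAL) through `j`. [cite: MochizukiAbsTopIII2015, Cor 1.10 (iii) p.43] -/
theorem autLiesOverInner_comp_mulEquiv_iff {Γ : Type v} {Γ' : Type w} [Group Γ] [Group Γ'] (j : E.gal →* Γ)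
    (ψ : Γ ≃* Γ') : E.AutLiesOverInner (ψ.toMonoidHom.comp j) ↔ E.AutLiesOverInner j := by
  refine ⟨fun h => ?_, fun h => h.map ψ.toMonoidHom⟩
  have h' := h.map ψ.symm.toMonoidHom
  have hj : ψ.symm.toMonoidHom.comp (ψ.toMonoidHom.comp j) = j := by
    ext x
    simp
  rwa [hj] at h'

/-- Two homomorphisms that agree pointwise give the same clause. [cite: MochizukiAbsTopIII2015, Cor 1.10 (iii) p.43] -/
theorem autLiesOverInner_congr {Γ : Type v} [Group Γ] {j j' : E.gal →* Γ} (hjj' : ∀ y, j y = j' y) :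
    E.AutLiesOverInner j ↔ E.AutLiesOverInner j' := by
  rw [MonoidHom.ext hjj']

/-- Inner automorphisms of `Π` always satisfy the clause: for `α = Inn(g)` take `τ := j(aug g)` (so (HGAL) is a
condition on OUTER automorphisms only). [cite: MochizukiAbsTopIII2015, Cor 1.10 (iii) p.43] -/
theorem exists_conj_of_inner {Γ : Type v} [Group Γ] (j : E.gal →* Γ) (g : E.arith) :
    ∃ τ : Γ, ∀ x : E.arith, j (E.aug (g * x * g⁻¹)) = τ * j (E.aug x) * τ⁻¹ :=
  ⟨j (E.aug g), fun x => by simp only [map_mul, map_inv]⟩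

/-! ### Shapes (res) and (aut) on MLF base data `B = (p, K, G ≅ Gal(K̄/K))` -/

namespace MLFBase

/-- `G → Gal(K̄/K) → Aut_{ℚ_p}(K̄)` for MLF base data `B = (p, K, galIso)` of an extension: the identification `galIso`
followed by restriction of scalars along `ℚ_p ⊆ K` ([AbsAnab] §1.1 p. 7 «`G = G_𝔭`»; [AbsTopIII] Cor. 1.10 p. 41 «an
MLF `k`»). [cite: MochizukiAbsTopIII2015, Cor 1.10 p.41] -/
def galRes (B : E.MLFBase) : E.gal →* (AlgebraicClosure B.K ≃ₐ[ℚ_[B.p]] AlgebraicClosure B.K) :=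
  (resAutPadic B.p B.K).comp B.galIso.toMonoidHom

/-- `galRes` pointwise. [cite: MochizukiAbsTopIII2015, Cor 1.10 p.41] -/
@[simp] theorem galRes_apply (B : E.MLFBase) (y : E.gal) :
    B.galRes y = (absoluteGaloisGroup.toAlgEquiv B.K (B.galIso y)).restrictScalars ℚ_[B.p] := rfl

/-- **(HGAL)^prof, shape (res)** — INTRINSIC to the MLF base data: for every `α : Π ≃ₜ* Π` there is
`τ ∈ Aut_{ℚ_p}(K̄)`, `K̄ := AlgebraicClosure K`, with `res(galIso(aug(α x))) = τ · res(galIso(aug x)) · τ⁻¹` for all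
`x ∈ Π` (conjugation inside `Aut_{ℚ_p}(K̄) ≅ G_{ℚ_p}` — `K̄` IS an algebraic closure of `ℚ_p`).  At abc-iut-L5's packaging
of `Π_v̲` (`gal = Gal(k̄/k)`, `galIso = refl`, `aug = augLoc`) this is VERBATIM the binder `hconj` of
`InitialThetaData.splitFromF_goodLocalFrobenioidOfEmb_of_conj_restrictScalars`.  A PREDICATE; nothing is asserted.
[cite: MochizukiAbsTopIII2015, Cor 1.10 (iii) p.43] -/
def ProfiniteHGal (B : E.MLFBase) : Prop :=
  E.AutLiesOverInner B.galRes

/-- Shape (res) unfolded. [cite: MochizukiAbsTopIII2015, Cor 1.10 (iii) p.43] -/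
theorem profiniteHGal_iff (B : E.MLFBase) :
    B.ProfiniteHGal ↔
      ∀ α : E.arith ≃ₜ* E.arith, ∃ τ : AlgebraicClosure B.K ≃ₐ[ℚ_[B.p]] AlgebraicClosure B.K, ∀ x : E.arith,
        (absoluteGaloisGroup.toAlgEquiv B.K (B.galIso (E.aug (α x)))).restrictScalars ℚ_[B.p] =
          τ * (absoluteGaloisGroup.toAlgEquiv B.K (B.galIso (E.aug x))).restrictScalars ℚ_[B.p] * τ⁻¹ :=
  Iff.rfl

/-- `G → G_{ℚ_p} = Aut_{ℚ_p}(ℚ̄_p)` through a DISPLAYED `ℚ_p`-isomorphism `e : K̄ ≃ ℚ̄_p`: `galRes` followed by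
`Aut_{ℚ_p}(K̄) ≅ Aut_{ℚ_p}(ℚ̄_p)`, `σ ↦ e ∘ σ ∘ e⁻¹` (Mathlib `AlgEquiv.autCongr`) — the `j` of shape (aut).
[cite: MochizukiAbsTopIII2015, Cor 1.10 (iii) p.43] -/
def toGQp (B : E.MLFBase) (e : AlgebraicClosure B.K ≃ₐ[ℚ_[B.p]] AlgebraicClosure ℚ_[B.p]) :
    E.gal →* (AlgebraicClosure ℚ_[B.p] ≃ₐ[ℚ_[B.p]] AlgebraicClosure ℚ_[B.p]) :=
  e.autCongr.toMonoidHom.comp B.galRes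

/-- `toGQp` pointwise: `e.autCongr (res (galIso y))`. [cite: MochizukiAbsTopIII2015, Cor 1.10 (iii) p.43] -/
@[simp] theorem toGQp_apply (B : E.MLFBase) (e : AlgebraicClosure B.K ≃ₐ[ℚ_[B.p]] AlgebraicClosure ℚ_[B.p]) (y : E.gal) :
    B.toGQp e y = e.autCongr ((absoluteGaloisGroup.toAlgEquiv B.K (B.galIso y)).restrictScalars ℚ_[B.p]) := rfl

/-- **(res) ⟺ (aut) for every `e`.** [cite: MochizukiAbsTopIII2015, Cor 1.10 (iii) p.43] -/
theorem autLiesOverInner_toGQp_iff (B : E.MLFBase) (e : AlgebraicClosure B.K ≃ₐ[ℚ_[B.p]] AlgebraicClosure ℚ_[B.p]) :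
    E.AutLiesOverInner (B.toGQp e) ↔ B.ProfiniteHGal :=
  autLiesOverInner_comp_mulEquiv_iff B.galRes e.autCongr

/-- Hence shape (aut) does not depend on the choice of `e : K̄ ≃ ℚ̄_p` (the DATA binder `e` of the layer-5 certificate
conjunct is inessential). [cite: MochizukiAbsTopIII2015, Cor 1.10 (iii) p.43] -/
theorem autLiesOverInner_toGQp_iff_toGQp (B : E.MLFBase) (e e' : AlgebraicClosure B.K ≃ₐ[ℚ_[B.p]] AlgebraicClosure ℚ_[B.p]) :
    E.AutLiesOverInner (B.toGQp e) ↔ E.AutLiesOverInner (B.toGQp e') := by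
  rw [autLiesOverInner_toGQp_iff, autLiesOverInner_toGQp_iff]

/-- Shape (aut) unfolded (the binder `hconj` of `…_of_conj_autCongr` at abc-iut-L5's packaging).
[cite: MochizukiAbsTopIII2015, Cor 1.10 (iii) p.43] -/
theorem autLiesOverInner_toGQp_iff_forall (B : E.MLFBase) (e : AlgebraicClosure B.K ≃ₐ[ℚ_[B.p]] AlgebraicClosure ℚ_[B.p]) :
    E.AutLiesOverInner (B.toGQp e) ↔
      ∀ α : E.arith ≃ₜ* E.arith, ∃ τ : AlgebraicClosure ℚ_[B.p] ≃ₐ[ℚ_[B.p]] AlgebraicClosure ℚ_[B.p],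
        ∀ x : E.arith,
          e.autCongr ((absoluteGaloisGroup.toAlgEquiv B.K (B.galIso (E.aug (α x)))).restrictScalars ℚ_[B.p]) =
            τ * e.autCongr ((absoluteGaloisGroup.toAlgEquiv B.K (B.galIso (E.aug x))).restrictScalars ℚ_[B.p])
              * τ⁻¹ :=
  Iff.rfl

/-! ### The chosen embedding `ι : ℚ̄_p → K̄` is an isomorphism; `absGaloisRestrict` is shape (aut) for `e = ι⁻¹` -/

/-- `K̄ := AlgebraicClosure K` is algebraic over `ℚ_p` (`K/ℚ_p` finite). [cite: NeukirchANT1999, Ch. II Thm. (4.8)] -/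
theorem isAlgebraic_padic_closure (B : E.MLFBase) : Algebra.IsAlgebraic ℚ_[B.p] (AlgebraicClosure B.K) :=
  haveI : Algebra.IsAlgebraic ℚ_[B.p] B.K := Algebra.IsAlgebraic.of_finite ℚ_[B.p] B.K
  Algebra.IsAlgebraic.trans ℚ_[B.p] B.K (AlgebraicClosure B.K)

/-- The tree's CHOSEN `ℚ_p`-embedding `ι = absClosureEmbedding ℚ_[p] K : ℚ̄_p → K̄` is BIJECTIVE: `K̄` is algebraic over
the algebraically closed field `ι(ℚ̄_p)`. [cite: NeukirchANT1999, Ch. II Thm. (4.8)] -/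
theorem absClosureEmbedding_padic_bijective (B : E.MLFBase) :
    Function.Bijective (absClosureEmbedding ℚ_[B.p] B.K) := by
  letI : Algebra (AlgebraicClosure ℚ_[B.p]) (AlgebraicClosure B.K) :=
    (absClosureEmbedding ℚ_[B.p] B.K).toRingHom.toAlgebra
  haveI : IsScalarTower ℚ_[B.p] (AlgebraicClosure ℚ_[B.p]) (AlgebraicClosure B.K) :=
    IsScalarTower.of_algebraMap_eq fun x => ((absClosureEmbedding ℚ_[B.p] B.K).commutes x).symm
  haveI := B.isAlgebraic_padic_closure
  haveI : Algebra.IsAlgebraic (AlgebraicClosure ℚ_[B.p]) (AlgebraicClosure B.K) :=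
    Algebra.IsAlgebraic.tower_top (K := ℚ_[B.p]) (AlgebraicClosure ℚ_[B.p])
  exact IsAlgClosed.algebraMap_bijective_of_isIntegral (k := AlgebraicClosure ℚ_[B.p]) (K := AlgebraicClosure B.K)

/-- The chosen embedding as a `ℚ_p`-ISOMORPHISM `ι : ℚ̄_p ≃ K̄` (uniqueness of algebraic closures, made to agree with the
tree's choice `absClosureEmbedding ℚ_[p] K`). [cite: NeukirchANT1999, Ch. II Thm. (4.8)] -/
def padicClosureEquiv (B : E.MLFBase) : AlgebraicClosure ℚ_[B.p] ≃ₐ[ℚ_[B.p]] AlgebraicClosure B.K :=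
  AlgEquiv.ofBijective (absClosureEmbedding ℚ_[B.p] B.K) B.absClosureEmbedding_padic_bijective

/-- `padicClosureEquiv` IS the chosen embedding. [cite: NeukirchANT1999, Ch. II Thm. (4.8)] -/
@[simp] theorem padicClosureEquiv_apply (B : E.MLFBase) (x : AlgebraicClosure ℚ_[B.p]) :
    B.padicClosureEquiv x = absClosureEmbedding ℚ_[B.p] B.K x := rfl

/-- A `ℚ_p`-isomorphism `e : K̄ ≃ ℚ̄_p` EXISTS (e.g. `ι⁻¹`; cf. `GaloisValDatum.nonempty_algEquiv_padicAlgCl` on abc-iut-L5's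
carrier). [cite: NeukirchANT1999, Ch. II Thm. (4.8)] -/
theorem nonempty_algEquiv_padic (B : E.MLFBase) : Nonempty (AlgebraicClosure B.K ≃ₐ[ℚ_[B.p]] AlgebraicClosure ℚ_[B.p]) :=
  ⟨B.padicClosureEquiv.symm⟩

/-- **The tree's restriction map `absGaloisRestrict ℚ_[p] K : Gal(K̄/K) → Gal(ℚ̄_p/ℚ_p)` is shape (aut) for `e = ι⁻¹`**:
on elements of `ℚ̄_p`, `(absGaloisRestrict σ) • x = ι⁻¹ (σ • ι x)`. [cite: MilneFT2022, Ch. 7 (restriction maps between absolute Galois groups)] -/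
theorem absGaloisRestrict_smul_eq (B : E.MLFBase) (σ : absoluteGaloisGroup B.K) (x : AlgebraicClosure ℚ_[B.p]) :
    absGaloisRestrict ℚ_[B.p] B.K σ • x = B.padicClosureEquiv.symm (σ • B.padicClosureEquiv x) := by
  apply B.padicClosureEquiv.injective
  rw [AlgEquiv.apply_symm_apply, padicClosureEquiv_apply, padicClosureEquiv_apply, absGaloisRestrict_apply_smul]

/-- The same as an identity of homomorphisms `Gal(K̄/K) → Gal(ℚ̄_p/ℚ_p)`:
`absGaloisRestrict ℚ_[p] K = (ι⁻¹).autCongr ∘ res` (through the identity `Gal(ℚ̄_p/ℚ_p) = Aut_{ℚ_p}(ℚ̄_p)`,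
`Field.absoluteGaloisGroup.toAlgEquiv`). [cite: MilneFT2022, Ch. 7 (restriction maps between absolute Galois groups)] -/
theorem absGaloisRestrict_eq_autCongr (B : E.MLFBase) (σ : absoluteGaloisGroup B.K) :
    absGaloisRestrict ℚ_[B.p] B.K σ =
      (absoluteGaloisGroup.toAlgEquiv ℚ_[B.p]).symm
        (B.padicClosureEquiv.symm.autCongr (resAutPadic B.p B.K σ)) := by
  apply (absoluteGaloisGroup.toAlgEquiv ℚ_[B.p]).injective
  ext x
  rw [MulEquiv.apply_symm_apply, ← absoluteGaloisGroup.smul_def, absGaloisRestrict_smul_eq]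
  simp [AlgEquiv.autCongr_apply, absoluteGaloisGroup.smul_def]

/-- Consequently `absGaloisRestrict ∘ galIso = ψ ∘ galRes` for the group ISOMORPHISM
`ψ := (ι⁻¹).autCongr` followed by `Aut_{ℚ_p}(ℚ̄_p) = Gal(ℚ̄_p/ℚ_p)`. [cite: MilneFT2022, Ch. 7 (restriction maps between absolute Galois groups)] -/
theorem absGaloisRestrict_comp_galIso_eq (B : E.MLFBase) :
    (absGaloisRestrict ℚ_[B.p] B.K).toMonoidHom.comp B.galIso.toMonoidHom =
      ((B.padicClosureEquiv.symm.autCongr.trans (absoluteGaloisGroup.toAlgEquiv ℚ_[B.p]).symm).toMonoidHom).comp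
        B.galRes := by
  ext y
  exact B.absGaloisRestrict_eq_autCongr (B.galIso y)

end MLFBase

end FundamentalExtension

/-! ### (abs) ⟺ (res) ⟺ (aut): the by-name fact of file (A) in the consumers' shapes -/

namespace AbsTopIII

variable {E : FundamentalExtension.{u}} (B : E.MLFBase)

/-- `AbsTopIII.ProfiniteAutOverGQp E B` (shape (abs), file (A)) is the generic clause through
`absGaloisRestrict ℚ_[p] K ∘ galIso`. [cite: MochizukiAbsTopIII2015, Cor 1.10 (iii) p.43] -/
theorem profiniteAutOverGQp_iff_autLiesOverInner_absGaloisRestrict :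
    ProfiniteAutOverGQp E B ↔
      E.AutLiesOverInner ((absGaloisRestrict ℚ_[B.p] B.K).toMonoidHom.comp B.galIso.toMonoidHom) :=
  Iff.rfl

/-- **(abs) ⟺ (res).**  The by-name fact `AbsTopIII.ProfiniteAutOverGQp E B` is equivalent to the intrinsic shape
`B.ProfiniteHGal` (`τ ∈ Aut_{ℚ_p}(K̄)`, restriction of scalars). [cite: MochizukiAbsTopIII2015, Cor 1.10 (iii) p.43] -/
theorem profiniteAutOverGQp_iff_profiniteHGal : ProfiniteAutOverGQp E B ↔ B.ProfiniteHGal := by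
  rw [profiniteAutOverGQp_iff_autLiesOverInner_absGaloisRestrict, B.absGaloisRestrict_comp_galIso_eq]
  exact FundamentalExtension.autLiesOverInner_comp_mulEquiv_iff B.galRes _

/-- **(abs) ⟺ (aut), for EVERY displayed `e : K̄ ≃ ℚ̄_p`.** [cite: MochizukiAbsTopIII2015, Cor 1.10 (iii) p.43] -/
theorem profiniteAutOverGQp_iff_autLiesOverInner_toGQp
    (e : AlgebraicClosure B.K ≃ₐ[ℚ_[B.p]] AlgebraicClosure ℚ_[B.p]) :
    ProfiniteAutOverGQp E B ↔ E.AutLiesOverInner (B.toGQp e) := by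
  rw [profiniteAutOverGQp_iff_profiniteHGal, B.autLiesOverInner_toGQp_iff]

/-- **Consumer-ready, shape (res)**: from the by-name fact, for every `α : Π ≃ₜ* Π` some `τ ∈ Aut_{ℚ_p}(K̄)` with
`res(galIso(aug(α x))) = τ · res(galIso(aug x)) · τ⁻¹` — at abc-iut-L5's packaging the binder `hconj` of
`InitialThetaData.splitFromF_goodLocalFrobenioidOfEmb_of_conj_restrictScalars` VERBATIM.
[cite: MochizukiAbsTopIII2015, Cor 1.10 (iii) p.43] -/
theorem ProfiniteAutOverGQp.exists_conj_restrictScalars (h : ProfiniteAutOverGQp E B) (α : E.arith ≃ₜ* E.arith) :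
    ∃ τ : AlgebraicClosure B.K ≃ₐ[ℚ_[B.p]] AlgebraicClosure B.K, ∀ x : E.arith,
      (absoluteGaloisGroup.toAlgEquiv B.K (B.galIso (E.aug (α x)))).restrictScalars ℚ_[B.p] =
        τ * (absoluteGaloisGroup.toAlgEquiv B.K (B.galIso (E.aug x))).restrictScalars ℚ_[B.p] * τ⁻¹ :=
  (profiniteAutOverGQp_iff_profiniteHGal B).mp h α

/-- **Consumer-ready, shape (aut)**: from the by-name fact and ANY displayed `e : K̄ ≃ ℚ̄_p`, for every `α : Π ≃ₜ* Π`
some `τ ∈ Aut_{ℚ_p}(ℚ̄_p) = G_{ℚ_p}` with `e.autCongr(res(galIso(aug(α x)))) = τ · e.autCongr(res(galIso(aug x))) · τ⁻¹`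
— at abc-iut-L5's packaging the binder `hconj` of `…_of_conj_autCongr` / `layer5_held_ex33iii_e_v18_conj` VERBATIM.
[cite: MochizukiAbsTopIII2015, Cor 1.10 (iii) p.43] -/
theorem ProfiniteAutOverGQp.exists_conj_autCongr (h : ProfiniteAutOverGQp E B)
    (e : AlgebraicClosure B.K ≃ₐ[ℚ_[B.p]] AlgebraicClosure ℚ_[B.p]) (α : E.arith ≃ₜ* E.arith) :
    ∃ τ : AlgebraicClosure ℚ_[B.p] ≃ₐ[ℚ_[B.p]] AlgebraicClosure ℚ_[B.p], ∀ x : E.arith,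
      e.autCongr ((absoluteGaloisGroup.toAlgEquiv B.K (B.galIso (E.aug (α x)))).restrictScalars ℚ_[B.p]) =
        τ * e.autCongr ((absoluteGaloisGroup.toAlgEquiv B.K (B.galIso (E.aug x))).restrictScalars ℚ_[B.p]) * τ⁻¹ :=
  (profiniteAutOverGQp_iff_autLiesOverInner_toGQp B e).mp h α

/-- Conversely, shape (res) gives the by-name fact (so a consumer may post either).
[cite: MochizukiAbsTopIII2015, Cor 1.10 (iii) p.43] -/
theorem profiniteAutOverGQp_of_profiniteHGal (h : B.ProfiniteHGal) : ProfiniteAutOverGQp E B :=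
  (profiniteAutOverGQp_iff_profiniteHGal B).mpr h

/-! ### The named fact of file (A) at a curve of the model -/

namespace CurveModel

open CategoryTheory

variable (M : CurveModel.{u})

/-- The model's identification `G ≅ Gal(k̄/k)` (`M.galIso X`, an isomorphism in `ProfiniteGrp`) as an isomorphism of
topological groups. [cite: MochizukiAbsTopIII2015, Cor 1.10 p.41] -/
def galEquiv (X : M.Curve) : (M.ext X).gal ≃ₜ* absoluteGaloisGroup (M.base X) where
  toFun := (M.galIso X).hom.hom
  invFun := (M.galIso X).inv.hom
  left_inv x := by
    change ((M.galIso X).hom ≫ (M.galIso X).inv).hom x = x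
    rw [(M.galIso X).hom_inv_id]
    rfl
  right_inv y := by
    change ((M.galIso X).inv ≫ (M.galIso X).hom).hom y = y
    rw [(M.galIso X).inv_hom_id]
    rfl
  map_mul' := map_mul (M.galIso X).hom.hom
  continuous_toFun := (M.galIso X).hom.hom.continuous
  continuous_invFun := (M.galIso X).inv.hom.continuous

/-- `galEquiv` IS `galIso` on elements. [cite: MochizukiAbsTopIII2015, Cor 1.10 p.41] -/
@[simp] theorem galEquiv_apply (X : M.Curve) (g : (M.ext X).gal) : M.galEquiv X g = (M.galIso X).hom.hom g := rfl

/-- The MLF base data of a curve of the model over a base field with `ℚ_p ⊆ k` finite: `(p, k, galEquiv)`.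
[cite: MochizukiAbsTopIII2015, Cor 1.10 p.41] -/
def mlfBase (X : M.Curve) (p : ℕ) [Fact p.Prime] [Algebra ℚ_[p] (M.base X)] [FiniteDimensional ℚ_[p] (M.base X)] :
    (M.ext X).MLFBase :=
  { p := p, K := M.base X, galIso := M.galEquiv X }

/-- **The named fact read at a curve**: `CurveModel.Cor_1_10_iii_galois M` (file (A)) gives, at every strictly-Belyi
curve `X` of the model over an MLF, the by-name clause `AbsTopIII.ProfiniteAutOverGQp (M.ext X) (M.mlfBase X p)` for the
model's OWN identification `galIso`. [cite: MochizukiAbsTopIII2015, Cor 1.10 (iii) p.43] -/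
theorem Cor_1_10_iii_galois.profiniteAutOverGQp {M : CurveModel.{u}} (h : M.Cor_1_10_iii_galois) (X : M.Curve)
    (p : ℕ) [Fact p.Prime] [Algebra ℚ_[p] (M.base X)] [FiniteDimensional ℚ_[p] (M.base X)]
    (hX : M.IsStrictlyBelyiType X) : AbsTopIII.ProfiniteAutOverGQp (M.ext X) (M.mlfBase X p) :=
  h X p hX (M.galEquiv X) (fun _ => rfl)

/-- … hence shape (res) at the curve: every topological automorphism `α` of `Π_X` lies over `Inn(τ)|_{G_k}` for some
`τ ∈ Aut_{ℚ_p}(k̄)`, through the model's `galIso` and restriction of scalars. [cite: MochizukiAbsTopIII2015, Cor 1.10 (iii) p.43] -/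
theorem Cor_1_10_iii_galois.exists_conj_restrictScalars {M : CurveModel.{u}} (h : M.Cor_1_10_iii_galois) (X : M.Curve)
    (p : ℕ) [Fact p.Prime] [Algebra ℚ_[p] (M.base X)] [FiniteDimensional ℚ_[p] (M.base X)]
    (hX : M.IsStrictlyBelyiType X) (α : (M.ext X).arith ≃ₜ* (M.ext X).arith) :
    ∃ τ : AlgebraicClosure (M.base X) ≃ₐ[ℚ_[p]] AlgebraicClosure (M.base X), ∀ x : (M.ext X).arith,
      (absoluteGaloisGroup.toAlgEquiv (M.base X) ((M.galIso X).hom.hom ((M.ext X).aug (α x)))).restrictScalars ℚ_[p] =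
        τ * (absoluteGaloisGroup.toAlgEquiv (M.base X) ((M.galIso X).hom.hom ((M.ext X).aug x))).restrictScalars ℚ_[p]
          * τ⁻¹ :=
  (h.profiniteAutOverGQp X p hX).exists_conj_restrictScalars (M.mlfBase X p) α

/-- … and shape (aut) at the curve, for any displayed `e : k̄ ≃ ℚ̄_p` (`τ ∈ Aut_{ℚ_p}(ℚ̄_p) = G_{ℚ_p}`).
[cite: MochizukiAbsTopIII2015, Cor 1.10 (iii) p.43] -/
theorem Cor_1_10_iii_galois.exists_conj_autCongr {M : CurveModel.{u}} (h : M.Cor_1_10_iii_galois) (X : M.Curve)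
    (p : ℕ) [Fact p.Prime] [Algebra ℚ_[p] (M.base X)] [FiniteDimensional ℚ_[p] (M.base X)]
    (hX : M.IsStrictlyBelyiType X) (e : AlgebraicClosure (M.base X) ≃ₐ[ℚ_[p]] AlgebraicClosure ℚ_[p])
    (α : (M.ext X).arith ≃ₜ* (M.ext X).arith) :
    ∃ τ : AlgebraicClosure ℚ_[p] ≃ₐ[ℚ_[p]] AlgebraicClosure ℚ_[p], ∀ x : (M.ext X).arith,
      e.autCongr ((absoluteGaloisGroup.toAlgEquiv (M.base X) ((M.galIso X).hom.hom ((M.ext X).aug (α x)))).restrictScalars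
          ℚ_[p]) =
        τ * e.autCongr ((absoluteGaloisGroup.toAlgEquiv (M.base X)
          ((M.galIso X).hom.hom ((M.ext X).aug x))).restrictScalars ℚ_[p]) * τ⁻¹ :=
  (h.profiniteAutOverGQp X p hX).exists_conj_autCongr (M.mlfBase X p) e α

end CurveModel

end AbsTopIII

end Literature.AnabelianGeometry.AbsoluteAnabelian
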